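import Mathlib

/-!
# Flag duality for the up-variation functional (K-line, DENSITY-XY ADDENDUM G.56)

[folklore] Elementary identities behind the self-duality `V_σ(μ) = V_{σ^rev}(μ̂)` of the flag
up-variation used in the reduction CONJECTURE K ⟸ CONJECTURE U (DENSITY-XY G.51″, G.56):

* `upVar_reflect_sub` : the up-variation `Σ_{k<n-1} (f(k+1) - f k)⁺` of a finite sequence is
  unchanged when the sequence is reversed and negated (`k ↦ K - f (n-1-k)`);
* `dualLevel_eq` : if atoms `0,…,n-1` are placed in this order with levels
  `c j = logw j + Σ_{k<j} D j k`, and the dual log-weights are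
  `logŵ i = K - logw i - Σ_{k<n, k≠i} D i k`, then the levels of the REVERSED order computed
  with the dual weights are `ĉ m = K - c (n-1-m)`;
* `upVar_dual` : hence both flags have the same up-variation.

In the application `D j k = 2 log |x_j - x_k|`, `K = log q_n`, and `ŵ_i = q_n / U_n(i)` are the
weights of the spectral measure of the Jacobi matrix at `e_n` (same off-diagonal entries), so the
minimum over flags of the up-variation is the same for `μ` and its dual `μ̂`.
-/

namespace Literature.MathematicalPhysics.QuantumLattice.Imbrie2016

open Finset

/-- [folklore] Up-variation of the finite sequence `f 0, …, f (n-1)`: `Σ_{k<n-1} (f (k+1) - f k)⁺`. -/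
noncomputable def upVar (n : ℕ) (f : ℕ → ℝ) : ℝ :=
  ∑ k ∈ range (n - 1), max (f (k + 1) - f k) 0

/-- [folklore] Reversing and negating a finite sequence preserves its up-variation. -/
theorem upVar_reflect_sub (n : ℕ) (f : ℕ → ℝ) (K : ℝ) :
    upVar n (fun k => K - f (n - 1 - k)) = upVar n f := by
  unfold upVar
  conv_lhs => rw [← Finset.sum_range_reflect]
  refine Finset.sum_congr rfl ?_
  intro j hj
  rw [Finset.mem_range] at hj
  have h1 : n - 1 - (n - 1 - 1 - j + 1) = j := by omega
  have h2 : n - 1 - (n - 1 - 1 - j) = j + 1 := by omega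
  simp only [h1, h2]
  congr 1
  ring

/-- [folklore] Level of the `j`-th placed atom (atoms labelled in placement order): `logw j + Σ_{k<j} D j k`. -/
noncomputable def level (n : ℕ) (logw : ℕ → ℝ) (D : ℕ → ℕ → ℝ) (j : ℕ) : ℝ :=
  logw j + ∑ k ∈ range n, if k < j then D j k else 0

/-- [folklore] Dual log-weights `K - logw i - Σ_{k<n, k≠i} D i k`. -/
noncomputable def dualLogw (n : ℕ) (logw : ℕ → ℝ) (D : ℕ → ℕ → ℝ) (K : ℝ) (i : ℕ) : ℝ :=
  K - logw i - ∑ k ∈ range n, if k ≠ i then D i k else 0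

/-- [folklore] Level of the `m`-th placed atom of the REVERSED order (`m ↦ n-1-m`) w.r.t. the dual weights. -/
noncomputable def dualLevel (n : ℕ) (logw : ℕ → ℝ) (D : ℕ → ℕ → ℝ) (K : ℝ) (m : ℕ) : ℝ :=
  dualLogw n logw D K (n - 1 - m) + ∑ l ∈ range n, if l < m then D (n - 1 - m) (n - 1 - l) else 0

/-- [folklore] The dual levels of the reversed flag are the reflected, negated levels. -/
theorem dualLevel_eq (n : ℕ) (logw : ℕ → ℝ) (D : ℕ → ℕ → ℝ) (K : ℝ) (m : ℕ) (hm : m < n) :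
    dualLevel n logw D K m = K - level n logw D (n - 1 - m) := by
  unfold dualLevel dualLogw level
  set i := n - 1 - m with hi
  have hrefl : (∑ l ∈ range n, if l < m then D i (n - 1 - l) else 0)
      = ∑ k ∈ range n, if i < k then D i k else 0 := by
    rw [← Finset.sum_range_reflect]
    refine Finset.sum_congr rfl ?_
    intro k hk
    rw [Finset.mem_range] at hk
    have hk' : n - 1 - (n - 1 - k) = k := by omega
    by_cases h : i < k
    · have : n - 1 - k < m := by omega
      simp [h, this, hk']
    · have : ¬ (n - 1 - k < m) := by omega
      simp [h, this]
  rw [hrefl]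
  have hsplit : (∑ k ∈ range n, if k ≠ i then D i k else 0)
      = (∑ k ∈ range n, if k < i then D i k else 0) + ∑ k ∈ range n, if i < k then D i k else 0 := by
    rw [← Finset.sum_add_distrib]
    refine Finset.sum_congr rfl ?_
    intro k hk
    by_cases h1 : k < i
    · have h2 : ¬ i < k := by omega
      have h3 : k ≠ i := by omega
      simp [h1, h2, h3]
    · by_cases h2 : i < k
      · have h3 : k ≠ i := by omega
        simp [h1, h2, h3]
      · have h3 : k = i := by omega
        simp [h3]
  rw [hsplit]
  ring

/-- [folklore] Flag duality: the reversed flag with dual weights has the same up-variation. -/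
theorem upVar_dual (n : ℕ) (logw : ℕ → ℝ) (D : ℕ → ℕ → ℝ) (K : ℝ) :
    upVar n (dualLevel n logw D K) = upVar n (level n logw D) := by
  have h : upVar n (dualLevel n logw D K) = upVar n (fun k => K - level n logw D (n - 1 - k)) := by
    unfold upVar
    refine Finset.sum_congr rfl ?_
    intro k hk
    rw [Finset.mem_range] at hk
    rw [dualLevel_eq n logw D K (k + 1) (by omega), dualLevel_eq n logw D K k (by omega)]
  rw [h, upVar_reflect_sub]

/-- [folklore] Telescoping lower bound: the up-variation dominates the net change. -/
theorem net_le_upVar (n : ℕ) (f : ℕ → ℝ) : f (n - 1) - f 0 ≤ upVar n f := by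
  unfold upVar
  have key : ∀ m : ℕ, f m - f 0 ≤ ∑ k ∈ range m, max (f (k + 1) - f k) 0 := by
    intro m
    induction m with
    | zero => simp
    | succ m ih =>
      rw [Finset.sum_range_succ]
      have := le_max_left (f (m + 1) - f m) 0
      linarith
  exact key (n - 1)

end Literature.MathematicalPhysics.QuantumLattice.Imbrie2016
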